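import Summits.NavierStokesRegularity.FluidComputer.PalasekTowerStrainDoorAtSharp
import Summits.NavierStokesRegularity.FluidComputer.PalasekTowerStrainShadowedRunPrice
import Summits.NavierStokesRegularity.FluidComputer.PalasekTowerRegisterWindowTuned

/-!
# THE PRICE OF THE NUMERAL STRAIN CERTIFICATE AT THE RE-BASED REGISTER `tuned`:
# any inhabitant of `StrainDoor.CertificateDataSharp TowerRates.tuned …` has window `h ≤ 2⁻⁸⁴`, total `L²` defect
# `(E₀ + G₂·w₀)·e^{∫Γ} ≤ 2⁻⁶⁵ ≈ 2.7·10⁻²⁰`, and its reference run more than DOUBLES its sup speed within `170` strain times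

Cell `ns-blowup`, seat `ns-blowup-refuter4` (g10, K208; ledger refuter of record for route `PalasekTowerBreakdown` rev 19,
crux stmt-NavierStokesRegularity-20303 `EpisodeBaseT := EpisodeBaseGAt TowerRates.tuned`, LEAD line `straindoor`:
`MechanismDoorAt tuned → CertificateSharpAt tuned → EpisodeBaseT`, `PalasekTowerStrainDoorAtSharp.lean` p530553). Negative-lane
PRICE lemmas only (`Theorems/<Crux>/Negative/`): no definition, no Theses statement asserted or denied, nothing about
Navier–Stokes decided. LABEL: refuter kernel certificate (E–C typing). WHAT THIS IS NOT: not NS — no datum, reference run or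
certificate is constructed; the numeral certificate `CertificateSharpAt tuned` stays OPEN; this file prices it.

fc-prover-3 (g10, `PalasekTowerStrainShadowedRunPrice.lean`, p530051) priced the numeral strain door REGISTER-GENERICALLY
(`budget_le_of_sharp_door`: `(E₀ + G₂T)e^{∫Γ} ≤ ¼ h^{3/4} ≤ ¼(216.72(2B_w+1))^{-3/2}`) and at the OLD register `wide`
(`budget_le_at_wide`: `B_w ≥ Y₁(wide) > 2778` ⟹ `h ≤ 10⁻¹²`, budget `≤ 10⁻⁹·e^{−∫Γ}` — "nine digits"). The route was RE-BASED
to `TowerRates.tuned = (2²⁴, 33/32, 12/5, 49/20)` (rev 19), where the level-`1` speed scale is `Y₁(tuned) = 2^{693/20} ≈ 2.7·10¹⁰`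
(§1). Since the budget scales like `B_w^{-3/2}` and every certificate's reference meets the speed face (`B_w > Y₁ + η + δ`), the
instance that matters for the live crux is:

* §2 `budget_le_at_tuned` — `B_w ≥ Y₁(tuned)` ⟹ `h ≤ 2⁻⁸⁴ (< 5.2·10⁻²⁶)` and `(E₀ + G₂T)·e^{∫Γ} ≤ 2⁻⁶⁵ (< 2.8·10⁻²⁰)`:
  TWENTY digits of ABSOLUTE `L²` accuracy (initial defect plus window-integrated Leray-projected residual) times the strain fee
  `e^{−∫Γ}` — eleven digits dearer than at `wide`;
* §3 at the certificate itself (`CertificateDataSharp tuned U ρ w g ϖ Γ Bw Gb G₂ D E₀ h δ η`): `tolerance_nonneg` (`0 ≤ δ`),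
  `datumSup_le_quarter` (`D ≤ 1/4`, from the numeral initial layer and `δ ≤ 1/2`), `speedBound_gt` (`Y₁ < B_w`, register-generic),
  `tuned_price` (the two bounds of §2 for the certificate's own `h, E₀, G₂, Γ` on `[0, wfirstAt tuned]`), and `tuned_doubling`:
  the reference starts sup-close to a datum of speed `< Y₀` — `‖w 0 y‖ < Y₀ + 1/4` everywhere — and ends with
  `‖w(w₀) x‖ > 2Y₀` at some `‖x‖ ≤ ρ` (`2Y₀ ≤ Y₁` at `tuned`, `TowerRates.tuned_sep`), on a window of `w₀·A₀ ≤ 170` level-`0`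
  strain times (`w₀·Y₀ ≤ 1/4`).

READING (for the LEAD ns-palasek-20303-p1, fc-prover-3 and the planner's repair census). At `tuned` the "letter a validated
computation checks" asks for a forced Navier–Stokes reference `(w, ϖ, g)` that more than doubles its maximum speed
(`> 2Y₀ ≈ 2.6·10¹⁰` from `< Y₀ + ¼`) inside `170` strain times while its initial `L²` defect PLUS `w₀ · sup_τ ‖g(τ)‖_{L²}` stays
below `2⁻⁶⁵·e^{−∫Γ}`; `Γ` dominates the maximal compression rate of `w`, which any gradient-amplifying incompressible flow makes
at least half its maximal stretching rate. In absolute terms this is a `10⁻²⁰` residual for a flow of speed `10¹⁰` and (finite-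
difference) gradients `> A₁ ≈ 7·10¹⁷` — not a double-precision interval computation; only an exact / closed-form or a
multiprecision-rigorous reference can pass. The factor `~2³⁵` of this price is the door's ABSOLUTE normalisation (`δ ≤ 1/2`, unit
perturbation ball `B_w + 1 + B_w`) against readout bands that tolerate `η + δ ≤ Y₁/3 ≈ 9·10⁹` (cap `5Y₁/3 − η − δ` vs floor
`Y₁ + η + δ`): a scale-covariant restatement of the sup-norm door (perturbation ball `θ·B_w`) is the cheap repair to try first;
the remaining `B_w^{-1/2}`-type loss is the `L² → L^∞` smoothing fee `h^{-3/4}`, `h ~ B_w^{-2}` of the Oseen slice theory.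
References: S. Palasek, arXiv:2605.13827 §4 [cite: Palasek2026ElementaryModel, §4]; M. Dashti, J. C. Robinson, SIAM J.
Numer. Anal. 46 (2008), Thm. 5 [cite: DashtiRobinson2008, Thm. 5].
-/

noncomputable section

namespace Summit.NavierStokesRegularity.EpisodeBaseTStrainDoorPrice

open Set MeasureTheory Metric
open scoped ENNReal NNReal
open Summit.NavierStokesRegularity.FluidComputer.PalasekTowerClayBridge
open Summit.NavierStokesRegularity.FluidComputer.PalasekTowerClayBridge.StrainDoor
open Summit.NavierStokesRegularity.FluidComputer.PalasekTowerClayBridge.StrainShadowSharp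

/-! ## §1 The tuned register at level `1` and the first window -/

/-- `Y₁(tuned) = N₁^{β−1} = (2^{24·33/32})^{7/5} = 2^{693/20}` (`≈ 2.6958·10¹⁰`). [folklore] -/
theorem tuned_Y_one_eq : TowerRates.tuned.Y 1 = (2 : ℝ) ^ ((693 : ℝ) / 20) := by
  have hβ : TowerRates.tuned.β = 12 / 5 := rfl
  rw [TowerRates.Y, TowerRates.tuned_N_eq_two_rpow 1, ← Real.rpow_mul (by norm_num : (0 : ℝ) ≤ 2), hβ]
  norm_num

/-- `2³⁴ = 17179869184 ≤ Y₁(tuned)`. [folklore] -/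
theorem tuned_Y_one_ge : (17179869184 : ℝ) ≤ TowerRates.tuned.Y 1 := by
  rw [tuned_Y_one_eq]
  have h : (17179869184 : ℝ) = (2 : ℝ) ^ (34 : ℝ) := by norm_num
  rw [h]
  exact Real.rpow_le_rpow_of_exponent_le (by norm_num) (by norm_num)

/-- The first tuned window counted in level-`0` strain times: `w₀ · A₀ = 4bβ·log N₁ = (99/10)·(99/4)·log 2 ≤ 170`.
[cite: Palasek2026ElementaryModel, §4] -/
theorem tuned_wfirst_mul_A_zero_le : Host.wfirstAt TowerRates.tuned * TowerRates.tuned.A 0 ≤ 170 := by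
  have hA : 0 < TowerRates.tuned.A 0 := TowerRates.tuned.A_pos 0
  have hb : TowerRates.tuned.b = 33 / 32 := rfl
  have hβ : TowerRates.tuned.β = 12 / 5 := rfl
  have hlog : Real.log (TowerRates.tuned.N 1) = 24 * (33 / 32) * Real.log 2 := by
    rw [TowerRates.tuned_N_eq_two_rpow 1, Real.log_rpow (by norm_num : (0 : ℝ) < 2)]
    ring
  have hw : Host.wfirstAt TowerRates.tuned * TowerRates.tuned.A 0 =
      4 * TowerRates.tuned.b * TowerRates.tuned.β * Real.log (TowerRates.tuned.N (0 + 1)) := by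
    show TowerRates.tuned.window 0 * TowerRates.tuned.A 0 = _
    rw [TowerRates.window]
    field_simp
  rw [hw, zero_add, hlog, hb, hβ]
  have h2 := Real.log_two_lt_d9
  nlinarith

/-! ## §2 The `L²` budget of the numeral door at the tuned register -/

/-- **THE PRICE AT THE `tuned` REGISTER.** Under the short-window and window-threshold hypotheses of the numeral strain
door (`StrainShadowSharp.exists_freeRun_near_of_strain`, p529071) with a speed bound `B_w ≥ Y₁(tuned)`:
`h ≤ 2⁻⁸⁴` and `(E₀ + G₂T)·e^{I} ≤ 2⁻⁶⁵` (`216.72·(2B_w + 1) ≥ 7.4464·10¹² ≥ 2⁴²`, then `budget_le_of_sharp_threshold`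
with `h^{3/4} ≤ (2⁻²¹)³`). [cite: DashtiRobinson2008, Thm. 5] -/
theorem budget_le_at_tuned {Bw E₀ G₂r T h δ I : ℝ} (hBw : TowerRates.tuned.Y 1 ≤ Bw) (hG : 0 ≤ G₂r)
    (hh : 0 < h) (hTs : (24 * (9.03 : ℝ) * (Bw + 1 + Bw)) ^ 2 * h ≤ 1) (hδ : δ ≤ 1 / 2)
    (hδ₂ : 2 * ((E₀ + G₂r * T) * Real.exp I + 4 * G₂r * h) * h ^ (-(3 / 4 : ℝ)) ≤ δ) :
    h ≤ 1 / 2 ^ 84 ∧ (E₀ + G₂r * T) * Real.exp I ≤ 1 / 2 ^ 65 := by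
  have hY := tuned_Y_one_ge
  have hBw0 : 0 < Bw := by linarith
  have hw := window_le_of_sharp hBw0 hTs
  have hX : (7446400000000 : ℝ) ≤ 216.72 * (2 * Bw + 1) := by linarith
  have hbig : (2 : ℝ) ^ 84 ≤ (216.72 * (2 * Bw + 1)) ^ 2 := by
    have h1 : (7446400000000 : ℝ) ^ 2 ≤ (216.72 * (2 * Bw + 1)) ^ 2 := by gcongr
    have h2 : (2 : ℝ) ^ 84 ≤ (7446400000000 : ℝ) ^ 2 := by norm_num
    exact h2.trans h1
  have hh84 : h ≤ 1 / 2 ^ 84 := hw.trans (one_div_le_one_div_of_le (by positivity) hbig)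
  refine ⟨hh84, ?_⟩
  have h1 := budget_le_of_sharp_threshold hG hh hδ hδ₂
  have ha : h ≤ ((1 : ℝ) / 2 ^ 21) ^ 4 := hh84.trans (le_of_eq (by norm_num))
  have h34 : h ^ (3 / 4 : ℝ) ≤ ((1 : ℝ) / 2 ^ 21) ^ 3 := by
    have h2 : h ^ (3 / 4 : ℝ) ≤ (((1 : ℝ) / 2 ^ 21) ^ 4) ^ (3 / 4 : ℝ) :=
      Real.rpow_le_rpow hh.le ha (by norm_num)
    have h3 : (((1 : ℝ) / 2 ^ 21) ^ 4) ^ (3 / 4 : ℝ) = ((1 : ℝ) / 2 ^ 21) ^ 3 := by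
      rw [← Real.rpow_natCast ((1 : ℝ) / 2 ^ 21) 4, ← Real.rpow_mul (by positivity),
        ← Real.rpow_natCast ((1 : ℝ) / 2 ^ 21) 3]
      norm_num
    rw [h3] at h2
    exact h2
  calc (E₀ + G₂r * T) * Real.exp I ≤ 1 / 4 * h ^ (3 / 4 : ℝ) := h1
    _ ≤ 1 / 4 * ((1 : ℝ) / 2 ^ 21) ^ 3 := by gcongr
    _ ≤ 1 / 2 ^ 65 := by norm_num

/-! ## §3 At the certificate: tolerance, datum defect, speed bound, the tuned price, speed doubling -/

section Generic

variable {R : TowerRates} {U : EuclideanSpace ℝ (Fin 3) → EuclideanSpace ℝ (Fin 3)} {ρ : ℝ}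
  {w g : ℝ → EuclideanSpace ℝ (Fin 3) → EuclideanSpace ℝ (Fin 3)} {ϖ : ℝ → EuclideanSpace ℝ (Fin 3) → ℝ}
  {Γ : ℝ → ℝ} {Bw Gb G₂ D E₀ h δ η : ℝ}

/-- The sup datum defect bound of a numeral certificate is nonnegative. [folklore] -/
theorem datumSup_nonneg (c : CertificateDataSharp R U ρ w g ϖ Γ Bw Gb G₂ D E₀ h δ η) : 0 ≤ D :=
  (norm_nonneg _).trans (c.datum_sup 0)

/-- The initial-layer term of a numeral certificate is nonnegative and at least `2D`. [folklore] -/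
theorem two_datumSup_le_layer (c : CertificateDataSharp R U ρ w g ϖ Γ Bw Gb G₂ D E₀ h δ η) :
    0 ≤ 2 * (D + 4 * h ^ (1 / 4 : ℝ) * G₂) * Real.exp (36 * (9.03 : ℝ) ^ 2 * (Bw + 1 + Bw) ^ 2 * h) ∧
    2 * D ≤ 2 * (D + 4 * h ^ (1 / 4 : ℝ) * G₂) * Real.exp (36 * (9.03 : ℝ) ^ 2 * (Bw + 1 + Bw) ^ 2 * h) := by
  have hD := datumSup_nonneg c
  have hh := c.h_pos
  have hG := c.G₂_nonneg
  have ha : 0 ≤ 4 * h ^ (1 / 4 : ℝ) * G₂ := by positivity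
  have he : 1 ≤ Real.exp (36 * (9.03 : ℝ) ^ 2 * (Bw + 1 + Bw) ^ 2 * h) :=
    Real.one_le_exp (by positivity)
  have hsum : 0 ≤ 2 * (D + 4 * h ^ (1 / 4 : ℝ) * G₂) := by positivity
  refine ⟨mul_nonneg hsum (zero_le_one.trans he), ?_⟩
  calc 2 * D ≤ 2 * (D + 4 * h ^ (1 / 4 : ℝ) * G₂) := by linarith
    _ = 2 * (D + 4 * h ^ (1 / 4 : ℝ) * G₂) * 1 := (mul_one _).symm
    _ ≤ 2 * (D + 4 * h ^ (1 / 4 : ℝ) * G₂) * Real.exp (36 * (9.03 : ℝ) ^ 2 * (Bw + 1 + Bw) ^ 2 * h) :=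
      mul_le_mul_of_nonneg_left he hsum

/-- **The tolerance of a numeral certificate is nonnegative** (`δ` dominates the initial layer). [folklore] -/
theorem tolerance_nonneg (c : CertificateDataSharp R U ρ w g ϖ Γ Bw Gb G₂ D E₀ h δ η) : 0 ≤ δ :=
  (two_datumSup_le_layer c).1.trans c.δ_layer

/-- **The sup datum defect of a numeral certificate is at most `1/4`** (`2D ≤ layer ≤ δ ≤ 1/2`). [folklore] -/
theorem datumSup_le_quarter (c : CertificateDataSharp R U ρ w g ϖ Γ Bw Gb G₂ D E₀ h δ η) : D ≤ 1 / 4 := by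
  have h1 := (two_datumSup_le_layer c).2.trans c.δ_layer
  have h2 := c.δ_le
  linarith

/-- **The speed bound of a numeral certificate exceeds the level-`1` scale**: `Y₁(R) < Y₁(R) + η + δ ≤ ‖w(w₀) x‖ ≤ B_w`.
[folklore] -/
theorem speedBound_gt (c : CertificateDataSharp R U ρ w g ϖ Γ Bw Gb G₂ D E₀ h δ η) : R.Y 1 < Bw := by
  obtain ⟨x, -, hx⟩ := c.speed
  have hB := c.speed_bdd (Host.wfirstAt R) ⟨(Host.wfirstAt_pos R).le, le_rfl⟩ x
  have hη := c.η_pos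
  have hδ := tolerance_nonneg c
  linarith

/-- **The reference of a numeral certificate starts sup-close to a sub-`Y₀` datum**: `‖w 0 y‖ < Y₀(R) + 1/4` everywhere.
[folklore] -/
theorem reference_initial_speed_lt (c : CertificateDataSharp R U ρ w g ϖ Γ Bw Gb G₂ D E₀ h δ η)
    (y : EuclideanSpace ℝ (Fin 3)) : ‖w 0 y‖ < R.Y 0 + 1 / 4 := by
  have h1 := c.datum_sup y
  have h2 := c.datum_lt y
  have h3 := datumSup_le_quarter c
  calc ‖w 0 y‖ = ‖U y + (w 0 y - U y)‖ := by congr 1; abel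
    _ ≤ ‖U y‖ + ‖w 0 y - U y‖ := norm_add_le _ _
    _ < R.Y 0 + 1 / 4 := by linarith

end Generic

variable {U : EuclideanSpace ℝ (Fin 3) → EuclideanSpace ℝ (Fin 3)} {ρ : ℝ}
  {w g : ℝ → EuclideanSpace ℝ (Fin 3) → EuclideanSpace ℝ (Fin 3)} {ϖ : ℝ → EuclideanSpace ℝ (Fin 3) → ℝ}
  {Γ : ℝ → ℝ} {Bw Gb G₂ D E₀ h δ η : ℝ}

/-- **THE PRICE OF ONE NUMERAL STRAIN CERTIFICATE AT `tuned`.** Any inhabitant of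
`CertificateDataSharp TowerRates.tuned U ρ w g ϖ Γ Bw Gb G₂ D E₀ h δ η` has terminal smoothing window `h ≤ 2⁻⁸⁴` and total
`L²` defect `(E₀ + G₂·wfirstAt tuned)·exp(∫₀^{wfirstAt tuned} Γ) ≤ 2⁻⁶⁵` (`< 2.8·10⁻²⁰`).
[cite: Palasek2026ElementaryModel, §4] [cite: DashtiRobinson2008, Thm. 5] -/
theorem tuned_price (c : CertificateDataSharp TowerRates.tuned U ρ w g ϖ Γ Bw Gb G₂ D E₀ h δ η) :
    h ≤ 1 / 2 ^ 84 ∧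
    (E₀ + G₂ * Host.wfirstAt TowerRates.tuned) *
        Real.exp (∫ s in (0 : ℝ)..Host.wfirstAt TowerRates.tuned, Γ s) ≤ 1 / 2 ^ 65 :=
  budget_le_at_tuned (speedBound_gt c).le c.G₂_nonneg c.h_pos c.h_short c.δ_le c.δ_window

/-- **SPEED DOUBLING INSIDE 170 STRAIN TIMES.** The reference run of any numeral strain certificate at `tuned` starts with
`‖w 0 y‖ < Y₀ + 1/4` everywhere and ends, at `w₀ = wfirstAt tuned`, with `‖w(w₀) x‖ > 2Y₀` at some `‖x‖ ≤ ρ`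
(`Y₁ + η + δ ≤ ‖w(w₀) x‖`, `2Y₀ ≤ Y₁` at `tuned`); the window has `w₀·A₀ ≤ 170` and `Y₀·w₀ ≤ 1/4`.
[cite: Palasek2026ElementaryModel, §4] -/
theorem tuned_doubling (c : CertificateDataSharp TowerRates.tuned U ρ w g ϖ Γ Bw Gb G₂ D E₀ h δ η) :
    (∀ y, ‖w 0 y‖ < TowerRates.tuned.Y 0 + 1 / 4) ∧
    (∃ x, ‖x‖ ≤ ρ ∧ 2 * TowerRates.tuned.Y 0 < ‖w (Host.wfirstAt TowerRates.tuned) x‖) ∧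
    Host.wfirstAt TowerRates.tuned * TowerRates.tuned.A 0 ≤ 170 ∧
    TowerRates.tuned.Y 0 * Host.wfirstAt TowerRates.tuned ≤ 1 / 4 := by
  refine ⟨reference_initial_speed_lt c, ?_, tuned_wfirst_mul_A_zero_le, TowerRates.tuned_Y_mul_window_le 0⟩
  obtain ⟨x, hx, hsp⟩ := c.speed
  refine ⟨x, hx, ?_⟩
  have hsep := TowerRates.tuned_sep 0
  have hη := c.η_pos
  have hδ := tolerance_nonneg c
  simp only [zero_add] at hsep
  linarith

end Summit.NavierStokesRegularity.EpisodeBaseTStrainDoorPrice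

end
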